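import Literature.Analysis.SegalBargmann.SchwartzTensorSchur
import Literature.Analysis.SegalBargmann.HermiteMatrixOperators
import HarnessLib

/-!
# The tensor product `A₁ ⊠̂ A₂` of continuous operators on `𝓢(ℝ^{σ₁ ⊕ σ₂})` via Hermite matrices (Reed–Simon V.13; Folland 1989, §1.7)

Topic `Analysis/SegalBargmann`; namespace `Literature.Analysis.SegalBargmann`.  In the `N`-representation a continuous
operator `A` of `𝓢(ℝ^σ)` is a tempered matrix `a(α, β) = c_α(A h_β)` acting on rapidly decreasing coefficient families
(`HermiteMatrixTempered`, `HermiteMatrixOperators`).  On `σ₁ ⊕ σ₂` the multi-indices are pairs, the Hermite functions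
are pure tensors and the coefficients of a pure tensor factor (`SchwartzTensorPi`, `SchwartzTensorSchur`).  Hence:

* §1 index algebra (`idxInl/idxInr`, `sumIdxEquiv : (σ₁ →₀ ℕ) × (σ₂ →₀ ℕ) ≃ (σ₁ ⊕ σ₂ →₀ ℕ)`, `degree_sumIdx`);
* §2 the Hermite matrix `matrixPi A α β := c_α(A h_β)` on the Folland carrier is entrywise tempered, and so is the
  PRODUCT KERNEL `prodKernel a¹ a² (α, β) := a¹(α|₁, β|₁) a²(α|₂, β|₂)` of two entrywise tempered kernels;
* §3 identification on pure tensors: ANY continuous `T` on `𝓢(ℝ^{σ₁ ⊕ σ₂})` whose Hermite matrix is the product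
  kernel of the matrices of `A₁, A₂` satisfies `T (f ⊠ g) = A₁ f ⊠ A₂ g` for ALL Schwartz `f, g`
  (`apply_tensorPi_of_piCoeff_eq_prodKernel`: absolute convergence, `tsum_mul_tsum_of_summable_norm`, and the
  coefficient action `c_α(A f) = Σ_β c_α(A h_β) c_β(f)`);
* §4 the operator **`tensorOp A₁ A₂ := hermiteMatrixCLM (a¹ ⊗ a²)`** (`IsTemperedKernel.of_entrywise`) (transported to the Folland carrier) with
  **`tensorOp_tensorPi : (A₁ ⊠̂ A₂)(f ⊠ g) = A₁ f ⊠ A₂ g`**, uniqueness / functoriality / `rhoS`-covariance, and the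
  two-factor Schur lemma with the constructed extension: **`exists_ne_zero_smul_tensorOp`** — a continuous
  automorphism `M` of `𝓢(ℝ^{σ₁ ⊕ σ₂})` implementing the block-diagonal phase-space map of `(s₁, s₂)` is `c • (A₁ ⊠̂ A₂)`,
  `c ≠ 0`, for any automorphisms `A_j` implementing `s_j`; so `M (f ⊠ g) = c • (A₁ f ⊠ A₂ g)` (pub-hodgecm node W2-⊗
  (⊗S), archimedean half of "restriction to the see-saw pair is the tensor of the small representations").

Everything is proved from Mathlib and the imported tree files; no cited statement is used as a hypothesis.

## References

* M. Reed, B. Simon, *Methods of Modern Mathematical Physics I*, Theorem V.13 and Appendix to §V.3 (`𝒮 ≅ s`).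
* [Folland1989] G. B. Folland, *Harmonic Analysis in Phase Space*, Princeton UP (1989), §1.4 Prop. (1.43), §1.7.
  [cite: Folland1989, §1.7]

## Provenance

LEAN-IN-TREE rule (2026-08-18), pub-hodgecm model-construction sub-cell, seat mc-binder-2 gen 3 (node W2-⊗, piece
(⊗S)-∞ P3b + P4 instantiated; P3 `HermiteMatrixOperators` by seat pv08 gen 20).
-/

set_option autoImplicit false

noncomputable section

open MeasureTheory Complex SchwartzMap Filter Topology
open scoped BigOperators Real

namespace Literature.Analysis.SegalBargmann

local notation "SR" σ:max => (SchwartzMap (σ → ℝ) ℂ)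
local notation "SE" σ:max => (SchwartzMap (EuclideanSpace ℝ σ) ℂ)

/-! ## §1  Multi-indices on `σ₁ ⊕ σ₂` are pairs -/

section Index

variable {σ₁ σ₂ : Type*}

/-- Restriction of a multi-index on `σ₁ ⊕ σ₂` to the `σ₁`-variables. [folklore] -/
def idxInl (α : σ₁ ⊕ σ₂ →₀ ℕ) : σ₁ →₀ ℕ := α.comapDomain Sum.inl Sum.inl_injective.injOn

/-- Restriction of a multi-index on `σ₁ ⊕ σ₂` to the `σ₂`-variables. [folklore] -/
def idxInr (α : σ₁ ⊕ σ₂ →₀ ℕ) : σ₂ →₀ ℕ := α.comapDomain Sum.inr Sum.inr_injective.injOn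

/-- `α|₁ i = α (inl i)`. [folklore] -/
@[simp] theorem idxInl_apply (α : σ₁ ⊕ σ₂ →₀ ℕ) (i : σ₁) : idxInl α i = α (Sum.inl i) :=
  Finsupp.comapDomain_apply _ _ _ _

/-- `α|₂ i = α (inr i)`. [folklore] -/
@[simp] theorem idxInr_apply (α : σ₁ ⊕ σ₂ →₀ ℕ) (i : σ₂) : idxInr α i = α (Sum.inr i) :=
  Finsupp.comapDomain_apply _ _ _ _

/-- `(α₁, α₂)|₁ = α₁`. [folklore] -/
@[simp] theorem idxInl_sumIdx (α₁ : σ₁ →₀ ℕ) (α₂ : σ₂ →₀ ℕ) : idxInl (sumIdx α₁ α₂) = α₁ := by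
  ext i; simp

/-- `(α₁, α₂)|₂ = α₂`. [folklore] -/
@[simp] theorem idxInr_sumIdx (α₁ : σ₁ →₀ ℕ) (α₂ : σ₂ →₀ ℕ) : idxInr (sumIdx α₁ α₂) = α₂ := by
  ext i; simp

/-- `sumIdx (α|₁) (α|₂) = α`. [folklore] -/
theorem sumIdx_idxInl_idxInr (α : σ₁ ⊕ σ₂ →₀ ℕ) : sumIdx (idxInl α) (idxInr α) = α := sumIdx_comapDomain α

/-- **Multi-indices on `σ₁ ⊕ σ₂` are pairs**: `(α₁, α₂) ↦ sumIdx α₁ α₂` is a bijection. [folklore] -/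
def sumIdxEquiv : (σ₁ →₀ ℕ) × (σ₂ →₀ ℕ) ≃ (σ₁ ⊕ σ₂ →₀ ℕ) where
  toFun p := sumIdx p.1 p.2
  invFun α := (idxInl α, idxInr α)
  left_inv p := by simp
  right_inv α := sumIdx_idxInl_idxInr α

/-- Unfolding. [folklore] -/
@[simp] theorem sumIdxEquiv_apply (p : (σ₁ →₀ ℕ) × (σ₂ →₀ ℕ)) : sumIdxEquiv p = sumIdx p.1 p.2 := rfl

variable [Fintype σ₁] [Fintype σ₂]

/-- The degree is additive over `sumIdx`: `|(α₁, α₂)| = |α₁| + |α₂|`. [folklore] -/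
theorem degree_sumIdx (α₁ : σ₁ →₀ ℕ) (α₂ : σ₂ →₀ ℕ) :
    (sumIdx α₁ α₂).degree = α₁.degree + α₂.degree := by
  simp [Finsupp.degree_eq_sum, Fintype.sum_sum_type]

/-- `|α| = |α|₁| + |α|₂|`. [folklore] -/
theorem degree_eq_idxInl_add_idxInr (α : σ₁ ⊕ σ₂ →₀ ℕ) :
    α.degree = (idxInl α).degree + (idxInr α).degree := by
  conv_lhs => rw [← sumIdx_idxInl_idxInr α]
  exact degree_sumIdx _ _

/-- `(a + b + 1) ≤ (a + 1)(b + 1)` for the degrees of the two restrictions. [folklore] -/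
theorem degree_add_one_le_mul (α : σ₁ ⊕ σ₂ →₀ ℕ) :
    ((α.degree : ℝ) + 1) ≤ (((idxInl α).degree : ℝ) + 1) * (((idxInr α).degree : ℝ) + 1) := by
  rw [degree_eq_idxInl_add_idxInr α]
  push_cast
  nlinarith [Nat.cast_nonneg (α := ℝ) (idxInl α).degree, Nat.cast_nonneg (α := ℝ) (idxInr α).degree]

/-- The restrictions have smaller degree: `|β|₁| + 1 ≤ |β| + 1` and `|β|₂| + 1 ≤ |β| + 1`. [folklore] -/
theorem degree_idxInl_add_one_le (β : σ₁ ⊕ σ₂ →₀ ℕ) :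
    (((idxInl β).degree : ℝ) + 1) ≤ (β.degree : ℝ) + 1 ∧ (((idxInr β).degree : ℝ) + 1) ≤ (β.degree : ℝ) + 1 := by
  rw [degree_eq_idxInl_add_idxInr β]
  push_cast
  constructor <;>
    linarith [Nat.cast_nonneg (α := ℝ) (idxInl β).degree, Nat.cast_nonneg (α := ℝ) (idxInr β).degree]

end Index

/-! ## §2  Hermite matrices on the Folland carrier and product kernels -/

section Matrix

variable {σ : Type*} [Fintype σ] [DecidableEq σ]

/-- **The Hermite matrix of an operator on the Folland carrier**: `matrixPi A α β := c_α(A h_β)`.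
[cite: Folland1989, §1.7] -/
def matrixPi (A : (SR σ) →L[ℂ] SR σ) (α β : σ →₀ ℕ) : ℂ := piCoeff α (A (hermitePi β))

/-- Unfolding. [folklore] -/
theorem matrixPi_apply (A : (SR σ) →L[ℂ] SR σ) (α β : σ →₀ ℕ) : matrixPi A α β = piCoeff α (A (hermitePi β)) := rfl

/-- The Folland-carrier matrix is the Euclidean-carrier matrix of the conjugated operator `e⁻¹ A e`. [folklore] -/
theorem matrixPi_eq_hermiteCoeff (A : (SR σ) →L[ℂ] SR σ) (α β : σ →₀ ℕ) :
    matrixPi A α β = hermiteCoeff α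
      ((((schwartzTransport (euclE σ)).symm : (SR σ) →L[ℂ] SE σ).comp
        (A.comp (schwartzTransport (euclE σ) : (SE σ) →L[ℂ] SR σ))) (hermiteSchwartz (herm β))) := by
  rw [matrixPi, piCoeff_def, ContinuousLinearMap.comp_apply, ContinuousLinearMap.comp_apply]
  rfl

/-- **The Hermite matrix of a continuous operator is entrywise tempered**: for every `m` there are `k, C` with
`(|α|+1)^m ‖c_α(A h_β)‖ ≤ C (|β|+1)^k`. [cite: Folland1989, §1.7] -/
theorem exists_degree_pow_mul_norm_matrixPi_le (A : (SR σ) →L[ℂ] SR σ) (m : ℕ) :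
    ∃ (k : ℕ) (C : ℝ), 0 ≤ C ∧ ∀ α β : σ →₀ ℕ,
      ((α.degree : ℝ) + 1) ^ m * ‖matrixPi A α β‖ ≤ C * ((β.degree : ℝ) + 1) ^ k := by
  obtain ⟨k, C, hC0, h⟩ := exists_degree_pow_mul_norm_matrix_le
    ((((schwartzTransport (euclE σ)).symm : (SR σ) →L[ℂ] SE σ).comp
      (A.comp (schwartzTransport (euclE σ) : (SE σ) →L[ℂ] SR σ)))) m
  exact ⟨k, C, hC0, fun α β => by rw [matrixPi_eq_hermiteCoeff]; exact h α β⟩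

/-- Zeroth-order form: `‖c_α(A h_β)‖ ≤ C (|β|+1)^k` uniformly in `α`. [cite: Folland1989, §1.7] -/
theorem exists_norm_matrixPi_le (A : (SR σ) →L[ℂ] SR σ) :
    ∃ (k : ℕ) (C : ℝ), 0 ≤ C ∧ ∀ α β : σ →₀ ℕ, ‖matrixPi A α β‖ ≤ C * ((β.degree : ℝ) + 1) ^ k := by
  obtain ⟨k, C, hC0, h⟩ := exists_degree_pow_mul_norm_matrixPi_le A 0
  exact ⟨k, C, hC0, fun α β => by simpa only [pow_zero, one_mul] using h α β⟩

/-- **The rows of the matrix act absolutely summably on coefficient sequences**: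
`Σ_β ‖c_α(A h_β) c_β(f)‖ < ∞`. [cite: Folland1989, §1.7] -/
theorem summable_norm_matrixPi_mul_piCoeff (A : (SR σ) →L[ℂ] SR σ) (α : σ →₀ ℕ) (f : SR σ) :
    Summable fun β : σ →₀ ℕ => ‖matrixPi A α β * piCoeff β f‖ := by
  obtain ⟨k, C, hC0, h⟩ := exists_norm_matrixPi_le A
  refine ((summable_degree_pow_mul_norm_piCoeff k f).mul_left C).of_nonneg_of_le (fun β => norm_nonneg _)
    fun β => ?_
  rw [norm_mul, ← mul_assoc]
  exact mul_le_mul_of_nonneg_right (h α β) (norm_nonneg _)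

/-- The coefficient action in matrix notation: `c_α(A f) = Σ' β, matrixPi A α β · c_β(f)`. [cite: Folland1989, §1.7] -/
theorem piCoeff_apply_eq_tsum_matrixPi (A : (SR σ) →L[ℂ] SR σ) (α : σ →₀ ℕ) (f : SR σ) :
    piCoeff α (A f) = ∑' β : σ →₀ ℕ, matrixPi A α β * piCoeff β f :=
  piCoeff_apply_eq_tsum A α f

end Matrix

section ProdKernel

variable {σ₁ σ₂ : Type*}

/-- **The product kernel** `(a¹ ⊗ a²)(α, β) := a¹(α|₁, β|₁) · a²(α|₂, β|₂)` on multi-indices of `σ₁ ⊕ σ₂`. [folklore] -/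
def prodKernel (a₁ : (σ₁ →₀ ℕ) → (σ₁ →₀ ℕ) → ℂ) (a₂ : (σ₂ →₀ ℕ) → (σ₂ →₀ ℕ) → ℂ)
    (α β : σ₁ ⊕ σ₂ →₀ ℕ) : ℂ :=
  a₁ (idxInl α) (idxInl β) * a₂ (idxInr α) (idxInr β)

/-- The product kernel on pairs: `(a¹ ⊗ a²)((α₁,α₂), (β₁,β₂)) = a¹(α₁,β₁) a²(α₂,β₂)`. [folklore] -/
@[simp] theorem prodKernel_sumIdx (a₁ : (σ₁ →₀ ℕ) → (σ₁ →₀ ℕ) → ℂ) (a₂ : (σ₂ →₀ ℕ) → (σ₂ →₀ ℕ) → ℂ)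
    (α₁ β₁ : σ₁ →₀ ℕ) (α₂ β₂ : σ₂ →₀ ℕ) :
    prodKernel a₁ a₂ (sumIdx α₁ α₂) (sumIdx β₁ β₂) = a₁ α₁ β₁ * a₂ α₂ β₂ := by
  simp [prodKernel]

variable [Fintype σ₁] [Fintype σ₂]

/-- **The product of two entrywise tempered kernels is entrywise tempered.** [folklore] -/
theorem prodKernel_tempered {a₁ : (σ₁ →₀ ℕ) → (σ₁ →₀ ℕ) → ℂ} {a₂ : (σ₂ →₀ ℕ) → (σ₂ →₀ ℕ) → ℂ}
    (h₁ : ∀ m : ℕ, ∃ (k : ℕ) (C : ℝ), 0 ≤ C ∧ ∀ α β : σ₁ →₀ ℕ,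
      ((α.degree : ℝ) + 1) ^ m * ‖a₁ α β‖ ≤ C * ((β.degree : ℝ) + 1) ^ k)
    (h₂ : ∀ m : ℕ, ∃ (k : ℕ) (C : ℝ), 0 ≤ C ∧ ∀ α β : σ₂ →₀ ℕ,
      ((α.degree : ℝ) + 1) ^ m * ‖a₂ α β‖ ≤ C * ((β.degree : ℝ) + 1) ^ k) (m : ℕ) :
    ∃ (k : ℕ) (C : ℝ), 0 ≤ C ∧ ∀ α β : σ₁ ⊕ σ₂ →₀ ℕ,
      ((α.degree : ℝ) + 1) ^ m * ‖prodKernel a₁ a₂ α β‖ ≤ C * ((β.degree : ℝ) + 1) ^ k := by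
  obtain ⟨k₁, C₁, hC₁, e₁⟩ := h₁ m
  obtain ⟨k₂, C₂, hC₂, e₂⟩ := h₂ m
  refine ⟨k₁ + k₂, C₁ * C₂, mul_nonneg hC₁ hC₂, fun α β => ?_⟩
  have hα := degree_add_one_le_mul α
  obtain ⟨hβ₁, hβ₂⟩ := degree_idxInl_add_one_le β
  have hα0 : (0 : ℝ) ≤ (α.degree : ℝ) + 1 := by positivity
  calc ((α.degree : ℝ) + 1) ^ m * ‖prodKernel a₁ a₂ α β‖
      ≤ ((((idxInl α).degree : ℝ) + 1) * (((idxInr α).degree : ℝ) + 1)) ^ m *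
          (‖a₁ (idxInl α) (idxInl β)‖ * ‖a₂ (idxInr α) (idxInr β)‖) := by
        rw [prodKernel, norm_mul]
        exact mul_le_mul_of_nonneg_right (pow_le_pow_left₀ hα0 hα m) (by positivity)
    _ = (((idxInl α).degree : ℝ) + 1) ^ m * ‖a₁ (idxInl α) (idxInl β)‖ *
          ((((idxInr α).degree : ℝ) + 1) ^ m * ‖a₂ (idxInr α) (idxInr β)‖) := by rw [mul_pow]; ring
    _ ≤ C₁ * (((idxInl β).degree : ℝ) + 1) ^ k₁ * (C₂ * (((idxInr β).degree : ℝ) + 1) ^ k₂) :=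
        mul_le_mul (e₁ _ _) (e₂ _ _) (by positivity) (by positivity)
    _ ≤ C₁ * ((β.degree : ℝ) + 1) ^ k₁ * (C₂ * ((β.degree : ℝ) + 1) ^ k₂) := by
        gcongr
    _ = C₁ * C₂ * ((β.degree : ℝ) + 1) ^ (k₁ + k₂) := by rw [pow_add]; ring

variable [DecidableEq σ₁] [DecidableEq σ₂]

/-- In particular the product kernel of the Hermite matrices of two continuous operators is entrywise tempered.
[cite: Folland1989, §1.7] -/
theorem prodKernel_matrixPi_tempered (A₁ : (SR σ₁) →L[ℂ] SR σ₁) (A₂ : (SR σ₂) →L[ℂ] SR σ₂) (m : ℕ) :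
    ∃ (k : ℕ) (C : ℝ), 0 ≤ C ∧ ∀ α β : σ₁ ⊕ σ₂ →₀ ℕ,
      ((α.degree : ℝ) + 1) ^ m * ‖prodKernel (matrixPi A₁) (matrixPi A₂) α β‖ ≤ C * ((β.degree : ℝ) + 1) ^ k :=
  prodKernel_tempered (exists_degree_pow_mul_norm_matrixPi_le A₁) (exists_degree_pow_mul_norm_matrixPi_le A₂) m

/-- The rows of an entrywise tempered kernel act absolutely summably on coefficient sequences. [folklore] -/
theorem summable_norm_kernel_mul_piCoeff {u : (σ₁ ⊕ σ₂ →₀ ℕ) → (σ₁ ⊕ σ₂ →₀ ℕ) → ℂ}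
    (hu : ∃ (k : ℕ) (C : ℝ), 0 ≤ C ∧ ∀ α β : σ₁ ⊕ σ₂ →₀ ℕ, ‖u α β‖ ≤ C * ((β.degree : ℝ) + 1) ^ k)
    (α : σ₁ ⊕ σ₂ →₀ ℕ) (F : SR (σ₁ ⊕ σ₂)) :
    Summable fun β : σ₁ ⊕ σ₂ →₀ ℕ => ‖u α β * piCoeff β F‖ := by
  obtain ⟨k, C, hC0, h⟩ := hu
  refine ((summable_degree_pow_mul_norm_piCoeff k F).mul_left C).of_nonneg_of_le (fun β => norm_nonneg _)
    fun β => ?_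
  rw [norm_mul, ← mul_assoc]
  exact mul_le_mul_of_nonneg_right (h α β) (norm_nonneg _)

end ProdKernel

/-! ## §3  An operator with product matrix is the tensor product on pure tensors -/

section Identify

variable {σ₁ σ₂ : Type*} [Fintype σ₁] [Fintype σ₂] [DecidableEq σ₁] [DecidableEq σ₂]

/-- **Identification on pure tensors.** If the Hermite matrix of a continuous operator `T` of `𝓢(ℝ^{σ₁ ⊕ σ₂})` is
the product kernel of the matrices of `A₁` and `A₂`, i.e. `c_α(T F) = Σ_β (a¹ ⊗ a²)(α,β) c_β(F)` for all `α, F`, then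
`T (f ⊠ g) = A₁ f ⊠ A₂ g` for all Schwartz `f, g`. [cite: Folland1989, §1.7] -/
theorem apply_tensorPi_of_piCoeff_eq_prodKernel (A₁ : (SR σ₁) →L[ℂ] SR σ₁) (A₂ : (SR σ₂) →L[ℂ] SR σ₂)
    (T : (SR (σ₁ ⊕ σ₂)) →L[ℂ] SR (σ₁ ⊕ σ₂))
    (hT : ∀ (α : σ₁ ⊕ σ₂ →₀ ℕ) (F : SR (σ₁ ⊕ σ₂)),
      piCoeff α (T F) = ∑' β : σ₁ ⊕ σ₂ →₀ ℕ, prodKernel (matrixPi A₁) (matrixPi A₂) α β * piCoeff β F)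
    (f : SR σ₁) (g : SR σ₂) : T (tensorPi f g) = tensorPi (A₁ f) (A₂ g) := by
  refine ext_piCoeff fun α => ?_
  rw [← sumIdx_idxInl_idxInr α]
  set α₁ := idxInl α
  set α₂ := idxInr α
  rw [piCoeff_sumIdx_tensorPi, piCoeff_apply_eq_tsum_matrixPi A₁, piCoeff_apply_eq_tsum_matrixPi A₂,
    tsum_mul_tsum_of_summable_norm (summable_norm_matrixPi_mul_piCoeff A₁ α₁ f)
      (summable_norm_matrixPi_mul_piCoeff A₂ α₂ g), hT, ← sumIdxEquiv.tsum_eq]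
  refine tsum_congr fun p => ?_
  simp only [sumIdxEquiv_apply, prodKernel_sumIdx, piCoeff_sumIdx_tensorPi]
  ring

end Identify

/-! ## §4  The tensor product operator `A₁ ⊠̂ A₂` -/


section TensorOp

variable {σ₁ σ₂ : Type*} [Fintype σ₁] [Fintype σ₂] [DecidableEq σ₁] [DecidableEq σ₂]

/-- The product kernel of the Hermite matrices of two continuous operators is a tempered kernel.
[cite: Folland1989, §1.7] -/
theorem isTemperedKernel_prodKernel_matrixPi (A₁ : (SR σ₁) →L[ℂ] SR σ₁) (A₂ : (SR σ₂) →L[ℂ] SR σ₂) :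
    IsTemperedKernel (prodKernel (matrixPi A₁) (matrixPi A₂)) :=
  IsTemperedKernel.of_entrywise (prodKernel_matrixPi_tempered A₁ A₂)

/-- **The tensor product `A₁ ⊠̂ A₂` of two continuous operators**, a continuous operator of `𝓢(ℝ^{σ₁ ⊕ σ₂})`: the
Hermite-matrix operator of the product kernel `c_{α₁}(A₁ h_{β₁}) c_{α₂}(A₂ h_{β₂})`, transported to the Folland
carrier. [cite: Folland1989, §1.7] -/
def tensorOp (A₁ : (SR σ₁) →L[ℂ] SR σ₁) (A₂ : (SR σ₂) →L[ℂ] SR σ₂) : (SR (σ₁ ⊕ σ₂)) →L[ℂ] SR (σ₁ ⊕ σ₂) :=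
  ((schwartzTransport (euclE (σ₁ ⊕ σ₂)) : (SE (σ₁ ⊕ σ₂)) →L[ℂ] SR (σ₁ ⊕ σ₂)).comp
    ((hermiteMatrixCLM (prodKernel (matrixPi A₁) (matrixPi A₂)) (isTemperedKernel_prodKernel_matrixPi A₁ A₂)).comp
      ((schwartzTransport (euclE (σ₁ ⊕ σ₂))).symm : (SR (σ₁ ⊕ σ₂)) →L[ℂ] SE (σ₁ ⊕ σ₂))))

/-- **The Hermite matrix of `A₁ ⊠̂ A₂` is the product kernel**:
`c_α((A₁ ⊠̂ A₂) F) = Σ_β c_{α|₁}(A₁ h_{β|₁}) c_{α|₂}(A₂ h_{β|₂}) c_β(F)`. [cite: Folland1989, §1.7] -/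
theorem piCoeff_tensorOp (A₁ : (SR σ₁) →L[ℂ] SR σ₁) (A₂ : (SR σ₂) →L[ℂ] SR σ₂) (α : σ₁ ⊕ σ₂ →₀ ℕ)
    (F : SR (σ₁ ⊕ σ₂)) :
    piCoeff α (tensorOp A₁ A₂ F) =
      ∑' β : σ₁ ⊕ σ₂ →₀ ℕ, prodKernel (matrixPi A₁) (matrixPi A₂) α β * piCoeff β F := by
  show piCoeff α (schwartzTransport (euclE (σ₁ ⊕ σ₂))
    (hermiteMatrixCLM (prodKernel (matrixPi A₁) (matrixPi A₂)) (isTemperedKernel_prodKernel_matrixPi A₁ A₂)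
      ((schwartzTransport (euclE (σ₁ ⊕ σ₂))).symm F))) = _
  rw [piCoeff_schwartzTransport, hermiteCoeff_hermiteMatrixCLM_eq_tsum]
  rfl

/-- **`(A₁ ⊠̂ A₂)(f ⊠ g) = A₁ f ⊠ A₂ g`** for all Schwartz `f, g`. [cite: Folland1989, §1.7] -/
theorem tensorOp_tensorPi (A₁ : (SR σ₁) →L[ℂ] SR σ₁) (A₂ : (SR σ₂) →L[ℂ] SR σ₂) (f : SR σ₁) (g : SR σ₂) :
    tensorOp A₁ A₂ (tensorPi f g) = tensorPi (A₁ f) (A₂ g) :=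
  apply_tensorPi_of_piCoeff_eq_prodKernel A₁ A₂ _ (piCoeff_tensorOp A₁ A₂) f g

/-- **Uniqueness of the extension**: a continuous operator agreeing with `A₁ · ⊠ A₂ ·` on pure tensors IS `A₁ ⊠̂ A₂`.
[folklore] -/
theorem eq_tensorOp_of_apply_tensorPi {A₁ : (SR σ₁) →L[ℂ] SR σ₁} {A₂ : (SR σ₂) →L[ℂ] SR σ₂}
    {T : (SR (σ₁ ⊕ σ₂)) →L[ℂ] SR (σ₁ ⊕ σ₂)} (hT : ∀ (f : SR σ₁) (g : SR σ₂), T (tensorPi f g) = tensorPi (A₁ f) (A₂ g)) :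
    T = tensorOp A₁ A₂ :=
  clm_eq_of_eq_on_tensorPi fun f g => by rw [hT, tensorOp_tensorPi]

/-- `1 ⊠̂ 1 = 1`. [folklore] -/
theorem tensorOp_id :
    tensorOp (ContinuousLinearMap.id ℂ (SR σ₁)) (ContinuousLinearMap.id ℂ (SR σ₂)) =
      ContinuousLinearMap.id ℂ (SR (σ₁ ⊕ σ₂)) :=
  (eq_tensorOp_of_apply_tensorPi fun _ _ => rfl).symm

/-- Functoriality: `(A₁ ⊠̂ A₂) ∘ (B₁ ⊠̂ B₂) = (A₁ B₁) ⊠̂ (A₂ B₂)`. [folklore] -/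
theorem tensorOp_comp (A₁ B₁ : (SR σ₁) →L[ℂ] SR σ₁) (A₂ B₂ : (SR σ₂) →L[ℂ] SR σ₂) :
    (tensorOp A₁ A₂).comp (tensorOp B₁ B₂) = tensorOp (A₁.comp B₁) (A₂.comp B₂) :=
  eq_tensorOp_of_apply_tensorPi fun f g => by
    rw [ContinuousLinearMap.comp_apply, tensorOp_tensorPi, tensorOp_tensorPi]; rfl

/-- **Covariance of `A₁ ⊠̂ A₂`**: if `A_j ρ(v) = ρ(s_j v) A_j` then
`(A₁ ⊠̂ A₂) ρ(v) = ρ(blockPhase s₁ s₂ v) (A₁ ⊠̂ A₂)`. [folklore] -/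
theorem tensorOp_rhoS {s₁ : (σ₁ → ℝ) × (σ₁ → ℝ) → (σ₁ → ℝ) × (σ₁ → ℝ)}
    {s₂ : (σ₂ → ℝ) × (σ₂ → ℝ) → (σ₂ → ℝ) × (σ₂ → ℝ)}
    (A₁ : (SR σ₁) →L[ℂ] SR σ₁) (A₂ : (SR σ₂) →L[ℂ] SR σ₂)
    (hA₁ : ∀ (p q : σ₁ → ℝ) (f : SR σ₁), A₁ (rhoS p q f) = rhoS (s₁ (p, q)).1 (s₁ (p, q)).2 (A₁ f))
    (hA₂ : ∀ (p q : σ₂ → ℝ) (g : SR σ₂), A₂ (rhoS p q g) = rhoS (s₂ (p, q)).1 (s₂ (p, q)).2 (A₂ g))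
    (P Q : σ₁ ⊕ σ₂ → ℝ) (F : SR (σ₁ ⊕ σ₂)) :
    tensorOp A₁ A₂ (rhoS P Q F) =
      rhoS (blockPhase s₁ s₂ (P, Q)).1 (blockPhase s₁ s₂ (P, Q)).2 (tensorOp A₁ A₂ F) :=
  tensor_covariant A₁ A₂ hA₁ hA₂ (tensorOp A₁ A₂) (tensorOp_tensorPi A₁ A₂) P Q F

/-- **Two-factor Schur lemma with the constructed extension (statement of record at the archimedean place).**
If `M` is a continuous linear automorphism of `𝓢(ℝ^{σ₁ ⊕ σ₂})` implementing the block-diagonal phase-space map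
`blockPhase s₁ s₂` (`M ρ(v) = ρ(S v) M`) and `A_j` are continuous linear automorphisms of `𝓢(ℝ^{σ_j})` implementing
`s_j`, then `M = c • (A₁ ⊠̂ A₂)` for ONE scalar `c ≠ 0`; in particular `M (f ⊠ g) = c • (A₁ f ⊠ A₂ g)` for all
`f, g`. [cite: Folland1989, Prop. (1.43)] -/
theorem exists_ne_zero_smul_tensorOp {s₁ : (σ₁ → ℝ) × (σ₁ → ℝ) → (σ₁ → ℝ) × (σ₁ → ℝ)}
    {s₂ : (σ₂ → ℝ) × (σ₂ → ℝ) → (σ₂ → ℝ) × (σ₂ → ℝ)} (M : (SR (σ₁ ⊕ σ₂)) ≃L[ℂ] SR (σ₁ ⊕ σ₂))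
    (hM : ∀ (P Q : σ₁ ⊕ σ₂ → ℝ) (F : SR (σ₁ ⊕ σ₂)),
      M (rhoS P Q F) = rhoS (blockPhase s₁ s₂ (P, Q)).1 (blockPhase s₁ s₂ (P, Q)).2 (M F))
    (A₁ : (SR σ₁) ≃L[ℂ] SR σ₁) (A₂ : (SR σ₂) ≃L[ℂ] SR σ₂)
    (hA₁ : ∀ (p q : σ₁ → ℝ) (f : SR σ₁), A₁ (rhoS p q f) = rhoS (s₁ (p, q)).1 (s₁ (p, q)).2 (A₁ f))
    (hA₂ : ∀ (p q : σ₂ → ℝ) (g : SR σ₂), A₂ (rhoS p q g) = rhoS (s₂ (p, q)).1 (s₂ (p, q)).2 (A₂ g)) :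
    ∃ c : ℂ, c ≠ 0 ∧ (∀ F, M F = c • tensorOp (A₁ : (SR σ₁) →L[ℂ] SR σ₁) (A₂ : (SR σ₂) →L[ℂ] SR σ₂) F) ∧
      ∀ (f : SR σ₁) (g : SR σ₂), M (tensorPi f g) = c • tensorPi (A₁ f) (A₂ g) :=
  exists_ne_zero_smul_of_tensor_covariant_equiv M hM A₁ A₂ hA₁ hA₂ (tensorOp _ _) (tensorOp_tensorPi _ _)

/-- The same for merely continuous NONZERO `A_j`. [cite: Folland1989, Prop. (1.43)] -/
theorem exists_ne_zero_smul_tensorOp' {s₁ : (σ₁ → ℝ) × (σ₁ → ℝ) → (σ₁ → ℝ) × (σ₁ → ℝ)}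
    {s₂ : (σ₂ → ℝ) × (σ₂ → ℝ) → (σ₂ → ℝ) × (σ₂ → ℝ)} (M : (SR (σ₁ ⊕ σ₂)) ≃L[ℂ] SR (σ₁ ⊕ σ₂))
    (hM : ∀ (P Q : σ₁ ⊕ σ₂ → ℝ) (F : SR (σ₁ ⊕ σ₂)),
      M (rhoS P Q F) = rhoS (blockPhase s₁ s₂ (P, Q)).1 (blockPhase s₁ s₂ (P, Q)).2 (M F))
    (A₁ : (SR σ₁) →L[ℂ] SR σ₁) (A₂ : (SR σ₂) →L[ℂ] SR σ₂) (hA₁0 : A₁ ≠ 0) (hA₂0 : A₂ ≠ 0)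
    (hA₁ : ∀ (p q : σ₁ → ℝ) (f : SR σ₁), A₁ (rhoS p q f) = rhoS (s₁ (p, q)).1 (s₁ (p, q)).2 (A₁ f))
    (hA₂ : ∀ (p q : σ₂ → ℝ) (g : SR σ₂), A₂ (rhoS p q g) = rhoS (s₂ (p, q)).1 (s₂ (p, q)).2 (A₂ g)) :
    ∃ c : ℂ, c ≠ 0 ∧ (∀ F, M F = c • tensorOp A₁ A₂ F) ∧
      ∀ (f : SR σ₁) (g : SR σ₂), M (tensorPi f g) = c • tensorPi (A₁ f) (A₂ g) :=
  exists_ne_zero_smul_of_tensor_covariant M hM A₁ A₂ hA₁0 hA₂0 hA₁ hA₂ (tensorOp _ _) (tensorOp_tensorPi _ _)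

end TensorOp

end Literature.Analysis.SegalBargmann

end
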